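import Mathlib
import Summits.ValiantsHypothesis.ValiantsHypothesis.Theses.MonotoneRestoration
import Summits.ValiantsHypothesis.ValiantsHypothesis.Theorems.MonotoneRestorationOrbitCut
import Summits.ValiantsHypothesis.ValiantsHypothesis.Theorems.MonotoneRestorationCruxToTarget
import Summits.ValiantsHypothesis.ValiantsHypothesis.Theorems.MonotoneRestorationSensitiveBridge
import Summits.ValiantsHypothesis.ValiantsHypothesis.Theorems.MonotoneRestorationDenseSubtraction

/-!
# Derived node `MonotoneRestoration.NonnegRestorationQP` (stmt-ValiantsHypothesis-16191) — line `orbit_cut`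

Skeleton line (line-writer `linewriter-valiant-liouvmonotone-1-g0`, 2026-08-31).  RECORD-GRADE: this
file registers, ON THIS ITEM, the route's certified cut; it opens no new front.

`NonnegRestorationQP`: every matrix-symmetric `VP` family `h_n ∈ ℝ≥0[x_ij]` (nonnegative coefficients)
has square-symmetric circuits over `ℂ` of quasi-polynomial SIZE.  It is a DERIVED node of the route:

  `NonnegRestorationQP ⟸ MonotoneRestorationQP` by the landed `CruxToTarget`
  (`Theorems.monotoneRestoration_cruxToTarget_proof`) with its two landed bridges `SensitiveBridge`
  (Hrubeš' ε-perturbation, `Theorems.MonotoneRestorationSensitive.sensitiveBridge_proof`) and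
  `DenseSubtraction` (`Theorems.denseSubtraction_proof`); and
  `MonotoneRestorationQP ⟸ OrbitRestorationQP ∧ OrbitCompressionQP` by the landed `OrbitCut`
  (`Theorems.MonotoneRestoration.orbitCut_proof`, through THEOREM ε
  `monotoneRestorationQP_iff_complexRestorationQP`).

So the only open content of this item is the pair of route items

* `stub_orbitRestoration` = `OrbitRestorationQP` (stmt-18293, the route's rank-2 crux and the sole
  binder of `closes`; OPEN, summit-carrying: L1 alone ⇒ VH by Dawar–Wilsenach Thm 7.1), and
* `stub_orbitCompression` = `OrbitCompressionQP` (stmt-18332, VH-free, banked `aside`: qp ORBIT size ⇒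
  qp SIZE for matrix-symmetric `VP` families),

stated here BY NAME (they are existing declarations with their own workfiles
`Cruxes/OrbitRestorationQP/…`; hands belong there, not here).  HOLD: the item is held by the negative
lemma `Theorems.nonnegRestorationQP_false_of_polylogWidthVP` (`PolylogWidthVP → ¬ NonnegRestorationQP`):
any proof along this line refutes `PolylogWidthVP`, consistently — `OrbitRestorationQP` already does
(`Theorems/MonotoneRestorationQP/Negative/OrbitRestorationFalseOfPolylogWidthVP.lean`).
-/

set_option linter.dupNamespace false

namespace Summit.ValiantsHypothesis.ValiantsHypothesis.Cruxes.NonnegRestorationQP.OrbitCut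

open Summit.ValiantsHypothesis.ValiantsHypothesis.Theses.MonotoneRestoration

/-- **Stub 1 = L1, the route crux `OrbitRestorationQP` (stmt-ValiantsHypothesis-18293; OPEN).**
Matrix-symmetric `VP` families over `ℂ` have square-symmetric circuits of quasi-polynomial ORBIT size.
[cite: DawarWilsenach2025, Theorem 7.1] [cite: DwivediPagoSeppelt2026, Outlook Q3] -/
theorem stub_orbitRestoration : OrbitRestorationQP := by
  sorry

/-- **Stub 2 = L2, the banked aside `OrbitCompressionQP` (stmt-ValiantsHypothesis-18332; OPEN, VH-free).**
A matrix-symmetric `VP` family with square-symmetric circuits of quasi-polynomial orbit size has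
square-symmetric circuits of quasi-polynomial size. [cite: DawarPagoSeppelt2025, Theorem 1.1] -/
theorem stub_orbitCompression : OrbitCompressionQP := by
  sorry

/-- **Composition (kernel-checked, from landed theorems):** `OrbitCut` (L1 ∧ L2 ⇒ `MonotoneRestorationQP`)
then `CruxToTarget` with the landed `SensitiveBridge` and `DenseSubtraction`. [folklore] -/
theorem NonnegRestorationQP_of : NonnegRestorationQP :=
  Summit.ValiantsHypothesis.ValiantsHypothesis.Theorems.monotoneRestoration_cruxToTarget_proof
    (Summit.ValiantsHypothesis.ValiantsHypothesis.Theorems.MonotoneRestoration.orbitCut_proof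
      stub_orbitRestoration stub_orbitCompression)
    Summit.ValiantsHypothesis.ValiantsHypothesis.Theorems.MonotoneRestorationSensitive.sensitiveBridge_proof
    Summit.ValiantsHypothesis.ValiantsHypothesis.Theorems.denseSubtraction_proof

end Summit.ValiantsHypothesis.ValiantsHypothesis.Cruxes.NonnegRestorationQP.OrbitCut
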